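import Summits.BirchSwinnertonDyer.BirchSwinnertonDyer.Theorems.EisensteinPrimesBSDpOnCellCTelescopeWeightTwoPseudoNullOfPub22
import HarnessLib

/-!
# Crux 4 `BSDpOnCellC` (stmt-BirchSwinnertonDyer-19034), telescope: TWIN OF THE WEIGHT-TWO PSEUDO-NULL LEAF (N2 chain, part 1) WITH THE 21-CONJUNCT
# CITE TEXT — no CGLS 2022 Prop. 1.2.5, no Castella 2018 Thms. 2.10–2.11 (width seat `bsd-line-x2-p2` gen 27; `--supports`, helper; CONDITIONAL)

WHAT: `weightTwoPseudoNullOfPub_lzz21` = the LEAD g9's landed `TelescopeWeightTwoPseudoNullOfPub22.weightTwoPseudoNullOfPub_lzz` (itself the twin of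
`TelescopeK2WeightTwoPseudoNull.weightTwoPseudoNullOfPub` without `thm210_thm211_bdpDisplay_pNew`) with the conjunct
`prop125_characterGrSelmerDual_torsion_muZero_dim` ALSO removed from the (vestigial) cite-text hypothesis; proof token-identical (the cite hypothesis is
introduced as `_hcite` and never read). The cite text here = V24's `hPub` (21 refereed names, `kolyvagin` kept) = telescope v22's `stub_publishedFacts21`
text minus EXACTLY the prop125 conjunct plus the `kolyvagin` conjunct (rebuilt from Darmon Thm. 3.22 + modularity + Gross–Zagier at the R-closure level,
as R4/R6 do). WHY: the N2 slot of the telescope composition feeds the WHOLE cite text to this leaf, so a composition on the 21-conjunct text needs a twin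
whose first hypothesis is that text (exactly the LEAD's reason for the `_lzz` twins). Host watch h-W-CAS-1 (LZZ `p`-range page-check) is inherited verbatim.
HONEST FRAMING: theorems only (no definition, no named fact, no instance, no `sorry`); CONDITIONAL on its hypotheses; closes no registered stub, no crux,
no summit statement; moves no count (the by-name register is re-booked, if at all, by the host on a landed closure and re-cut only by a LEAD under a
director word). BSD is proved for no curve by this file.
-/

set_option autoImplicit false
set_option linter.dupNamespace false

noncomputable section

open scoped Classical MatrixGroups ModularForm

open CongruenceSubgroup WeierstrassCurve NumberField IsDedekindDomain Field PowerSeries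
  Literature.NumberTheory.EllipticCurves Literature.NumberTheory.EllipticCurves.GreenbergSelmer
  Literature.NumberTheory.EllipticCurves.ModularForms Literature.NumberTheory.QuadraticFields
  Literature.NumberTheory.EllipticCurves.Rank1Residual
  Literature.NumberTheory.EllipticCurves.Rank1Residual.Typed
  Literature.NumberTheory.EllipticCurves.KrizLi2019
  Literature.NumberTheory.EllipticCurves.GreenbergVatsal2000
  Literature.NumberTheory.EllipticCurves.Wuthrich2014
  Literature.NumberTheory.EllipticCurves.SteinWuthrich2013
  Literature.NumberTheory.EllipticCurves.Castella2018Exceptional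
  Literature.NumberTheory.GaloisRepresentations Literature.NumberTheory.GaloisCohomology
  Literature.NumberTheory.Automorphic
  Summit.BirchSwinnertonDyer.Rank1Residual.X11b.AcSelmer
  Summit.BirchSwinnertonDyer.Rank1Residual.X11b.Halves
  Summit.BirchSwinnertonDyer.Rank1Residual.X11b
  Summit.BirchSwinnertonDyer.Rank1Residual Summit.BirchSwinnertonDyer.Rank1Residual.X1
  Summit.BirchSwinnertonDyer.Rank1Residual.X2
open Literature.NumberTheory.EllipticCurves.KellerYin2024 (curveLocalLambda)

open Literature.NumberTheory.EllipticCurves.BigGaloisRep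

namespace Summit.BirchSwinnertonDyer.BirchSwinnertonDyer.Theorems.TelescopeWeightTwoPseudoNullOfPub21

open Literature.NumberTheory.EllipticCurves.CastellaGrossiLeeSkinner2022 Literature.NumberTheory.EllipticCurves.Castella2018
  Literature.NumberTheory.IwasawaTheory Literature.NumberTheory.IwasawaTheory.Greenberg2016
  Literature.NumberTheory.IwasawaTheory.Greenberg2006
  Summit.BirchSwinnertonDyer.Rank1Residual.X1.KellerYinMuLambdaSplit
open Literature.NumberTheory.EllipticCurves.KellerYin2024
open Summit.BirchSwinnertonDyer.BirchSwinnertonDyer.Theorems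

set_option maxHeartbeats 1600000 in
/-- **Twin of `TelescopeWeightTwoPseudoNullOfPub22.weightTwoPseudoNullOfPub_lzz` (LEAD g9) with the 21-conjunct cite text** (no CGLS Prop. 1.2.5, no [cas-split]); the cite hypothesis is vestigial (`_hcite`), proof token-identical. CONDITIONAL on its binders; nothing booked. [cite: Greenberg2016Selmer, Prop. 4.1.1 (shape only)] -/
theorem weightTwoPseudoNullOfPub_lzz21 :
    ((((lambdaMu_multiplicative_of_gvPar ∧ thm16_charIdeal_dvd_multiplicative_of_reducible ∧
    thm61_splitMultiplicative ∧ thm61_nonsplitMultiplicative ∧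
    (∀ (W : WeierstrassCurve ℚ) [W.IsElliptic] [W.IsGloballyMinimal] (p : ℕ) [Fact p.Prime], greenberg_stevens (W := W) (p := p)) ∧
    exists_isNewformOf ∧ hsieh2014_exists_anticyclotomicPAdicLFunction ∧
    (∀ (N : ℕ) [NeZero N] (W : WeierstrassCurve ℚ) (K : Type) [Field K] [NumberField K], gross_zagier N W K) ∧
    (∀ (N : ℕ) [NeZero N] (W : WeierstrassCurve ℚ) (K : Type) [Field K] [NumberField K], kolyvagin N W K) ∧
    rank_eq_analyticRank_of_analyticRank_le_one ∧ HoffsteinLuo1997_exists_twist_L_one_ne_zero ∧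
    mazur_not_dvd_maninConstant_of_odd ∧ bsdRHS_eq_of_isIsogenous) ∧
    LiuZhangZhang2018.thm151_thm153_modularCurve_heegnerVector) ∧
    (cor126_residualCharacter_globalLift ∧ cor126_residualCharacter_localSurjective ∧ thm212_exists_isKatzLFunction ∧
      Literature.NumberTheory.EllipticCurves.Castella2018.cas20_thm211_memberForms_sigmaFrames_congr)) ∧
      Literature.NumberTheory.EllipticCurves.BCGKPST2020.thm331_rubin_exists_katzMeasure₂_pseudoIso_span_eq ∧
      Literature.NumberTheory.EllipticCurves.DeShalit1987.thmII64_katzMeasure₂_functionalEquation ∧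
      Literature.NumberTheory.EllipticCurves.Hida2010MuInvariant.thmI_mu_katzBranch_reflect_eq_zero) →
    ∀ (W : WeierstrassCurve ℚ) [W.IsElliptic] [W.IsGloballyMinimal] (p : ℕ) [Fact p.Prime],
    ∀ (N : ℕ) [NeZero N] (K : Type) [Field K] [NumberField K] (Dt : ModularParametrizationData W N)
      (H : HeegnerDatum N (NumberField.discr K)) (ιK : K →+* ℂ) (P : (W.baseChange K).toAffine.Point), CellC W p → W.conductorNorm ℤ = N →
      IsImaginaryQuadratic K → NumberField.discr K < -4 → SatisfiesHeegnerHypothesis N K →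
      (W.quadraticTwist (NumberField.discr K : ℚ)).entireLFunction 1 ≠ 0 →
      WeierstrassCurve.Affine.Point.map ιK.toRatAlgHom P = heegnerPointComplex Dt H → ¬ (p : ℤ) ∣ Dt.c → ¬ IsOfFinAddOrder P →
      Odd (NumberField.discr K) → ∀ (κ : ZpExtension K p), κ.IsAnticyclotomic → ∀ (γ : Field.absoluteGaloisGroup K) [Fact (κ.IsTopGenerator γ)]
          (𝔭 : HeightOneSpectrum (𝓞 K)), ((p : ℕ) : 𝓞 K) ∈ 𝔭.asIdeal → 𝔭.asIdeal.ramificationIdx (𝓞 ℚ) = 1 → 𝔭.asIdeal.inertiaDeg (𝓞 ℚ) = 1 →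
          ∀ (𝔭bar : HeightOneSpectrum (𝓞 K)), ((p : ℕ) : 𝓞 K) ∈ 𝔭bar.asIdeal → 𝔭bar ≠ 𝔭 → ((Ideal.span {(p : ℤ)}).primesOver (𝓞 K)).ncard = 2 →
          ∀ (f : CuspForm (CongruenceSubgroup.Gamma0 N) 2), IsNewformOf W f → ∀ (ι' : PadicAlgCl p ≃+* ℂ), (∀ (w : InfinitePlace K) (k : 𝓞 K),
                k ∈ 𝔭.asIdeal ↔ ‖ι'.symm (w.embedding (k : K))‖ < 1) → ∀ (ΩK : ℂ) (Ωp : ℂ_[p]) (Q : PowerSeries 𝓞_ℂ_[p]), ΩK ≠ 0 → ‖Ωp‖ = 1 →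
                R1.IsBDPLFunctionInt p ι' 𝔭 κ γ f ΩK Ωp Q →
      ∀ (L : PowerSeries (PowerSeries (unrIntegers p))) (x : ℕ → ℤ_[p]) (D : ℕ → Skinner2016.HidaCongruentForm W p 1),
        (∀ k, ‖x k‖ < 1) ∧ Filter.Tendsto x Filter.atTop (nhds 0) ∧ (∃ e : ℕ, PowerSeries.C ((p : 𝓞_ℂ_[p]) ^ e) * Q ∈
          Ideal.span {PowerSeries.map (R1.unrToCpInt p) (PowerSeries.map (PowerSeries.constantCoeff (R := unrIntegers p)) L)}) ∧
        (∀ k : ℕ, (∀ y : coeffField (D k).g, ι' ((D k).ι y) = (y : ℂ)) ∧ 2 * ((p : ℤ) - 1) ∣ (D k).k - 2 ∧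
          ∃ (ΩKg : ℂ) (Ωpg : ℂ_[p]) (Lg : UnrSeries p), ΩKg ≠ 0 ∧ ‖Ωpg‖ = 1 ∧ IsBDPLFunctionWt ι' 𝔭 κ γ (D k).g ΩKg Ωpg Lg ∧ ∃ Ψ : UnrSeries p,
            (∃ U : PowerSeries (PowerSeries (unrIntegers p)), PowerSeries.map (PowerSeries.C (R := unrIntegers p)) Ψ =
                L + PowerSeries.C (PowerSeries.X - PowerSeries.C (toUnr p (x k))) * U) ∧
            (∃ e : ℕ, PowerSeries.C ((p : 𝓞_ℂ_[p]) ^ e) * PowerSeries.map (R1.unrToCpInt p) Ψ ∈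
              Ideal.span {PowerSeries.map (R1.unrToCpInt p) Lg})) ∧ (∃ A : ℕ → UnrSeries p, ∀ ℓ : ℕ, ℓ.Prime → ¬ ℓ ∣ N →
          (∃ U : UnrSeries p, A ℓ = PowerSeries.C (toUnr p ((W.frobeniusTrace ℓ : ℤ) : ℤ_[p])) + PowerSeries.X * U) ∧
          ∀ k : ℕ, ∃ (c : unrIntegers p) (U : UnrSeries p), A ℓ = PowerSeries.C c + (PowerSeries.X - PowerSeries.C (toUnr p (x k))) * U ∧
            ((c : ℂ_[p]) = algebraMap (PadicAlgCl p) ℂ_[p]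
              ((D k).ι ⟨(UpperHalfPlane.qExpansion 1 ⇑(D k).g).coeff ℓ, coeff_mem_coeffField (D k).g ℓ⟩))) →
      ∀ [TopologicalSpace (PowerSeries ℤ_[p])] (A₂ : Type) [AddCommGroup A₂]
        [Module (PowerSeries ℤ_[p]) A₂] [TopologicalSpace A₂] [DiscreteTopology A₂]
        (ρ₂ : ContinuousRep (Field.absoluteGaloisGroup K) (PowerSeries ℤ_[p]) A₂) [TopologicalSpace (PowerSeries (PowerSeries ℤ_[p]))] [IsTopologicalRing (PowerSeries (PowerSeries ℤ_[p]))]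
        [ContinuousSMul (PowerSeries (PowerSeries ℤ_[p])) (BigRepModule (PowerSeries ℤ_[p]) p A₂)],
        (Literature.NumberTheory.IwasawaTheory.Greenberg2016.IsCofree (PowerSeries ℤ_[p]) A₂ ∧
          (∀ a : A₂, ∃ n : ℕ, (PowerSeries.X : PowerSeries ℤ_[p]) ^ n • a = 0) ∧ (∀ a : A₂, ∃ b : A₂, (PowerSeries.X : PowerSeries ℤ_[p]) • b = a) ∧
          (∀ (k : ℕ) (a : A₂), ∃ b : A₂, (PowerSeries.X - PowerSeries.C (x k)) • b = a) ∧
          (∃ S₀ : Set (HeightOneSpectrum (𝓞 K)), S₀.Finite ∧ GaloisRep.IsUnramifiedOutside S₀ ρ₂ ∧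
            ∀ w ∈ S₀, ((p : ℕ) : 𝓞 K) ∉ w.asIdeal → ((N : ℕ) : 𝓞 K) ∈ w.asIdeal) ∧
          (∃ θ₀ : Submodule.torsionBy (PowerSeries ℤ_[p]) A₂ (PowerSeries.X : PowerSeries ℤ_[p]) →+ PrimaryTorsion (W.baseChange K).geomPoints p,
            (∀ (c : ℤ_[p]) (a : Submodule.torsionBy (PowerSeries ℤ_[p]) A₂ (PowerSeries.X : PowerSeries ℤ_[p])),
                θ₀ (PowerSeries.C c • a) = c • θ₀ a) ∧ (∀ (σ : Field.absoluteGaloisGroup K)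
                (a : Submodule.torsionBy (PowerSeries ℤ_[p]) A₂ (PowerSeries.X : PowerSeries ℤ_[p])),
                θ₀ (BigGaloisRep.torsionRep ρ₂ (PowerSeries.X : PowerSeries ℤ_[p]) σ a) = (W.baseChange K).primaryTorsionGaloisRep p σ (θ₀ a)) ∧
            Finite θ₀.ker ∧ Finite (PrimaryTorsion (W.baseChange K).geomPoints p ⧸ θ₀.range)) ∧
          (∀ k : ℕ, Function.Surjective (algebraMap ℤ_[p] (padicCoeffIntegers (D k).ι)) ∧
            ∃ θ : Submodule.torsionBy (PowerSeries ℤ_[p]) A₂ (PowerSeries.X - PowerSeries.C (x k)) →+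
                Cofree (D k).Δ.selfDualRep (padicCoeffField (D k).ι), (∀ (c : ℤ_[p])
                  (a : Submodule.torsionBy (PowerSeries ℤ_[p]) A₂ (PowerSeries.X - PowerSeries.C (x k))),
                  θ (PowerSeries.C c • a) = algebraMap ℤ_[p] (padicCoeffIntegers (D k).ι) c • θ a) ∧ (∀ (σ : Field.absoluteGaloisGroup K)
                  (a : Submodule.torsionBy (PowerSeries ℤ_[p]) A₂ (PowerSeries.X - PowerSeries.C (x k))),
                  θ (BigGaloisRep.torsionRep ρ₂ (PowerSeries.X - PowerSeries.C (x k)) σ a) = (D k).Δ.selfDualCofreeRepOver K σ (θ a)) ∧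
              Finite θ.ker ∧ Finite (Cofree (D k).Δ.selfDualRep (padicCoeffField (D k).ι) ⧸ θ.range))) →
        Module.Finite (PowerSeries (PowerSeries ℤ_[p])) (XBig κ ρ₂ 𝔭bar (∅ : Set (HeightOneSpectrum (𝓞 K)))) →
        (∃ s : PowerSeries (PowerSeries ℤ_[p]), ¬ (PowerSeries.C (PowerSeries.X : PowerSeries ℤ_[p]) ∣ s) ∧
            ∀ m : XBig κ ρ₂ 𝔭bar (∅ : Set (HeightOneSpectrum (𝓞 K))), s • m = 0) →
        ∀ P : Submodule (PowerSeries (PowerSeries ℤ_[p])) (XBig κ ρ₂ 𝔭bar (∅ : Set (HeightOneSpectrum (𝓞 K)))),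
          Literature.NumberTheory.EllipticCurves.Module.IsPseudoNull (PowerSeries (PowerSeries ℤ_[p])) ↥P →
            ∃ m : ℕ, ∀ x ∈ P, (p : PowerSeries (PowerSeries ℤ_[p])) ^ m • x = 0 := by
  intro _hcite W _ _ p _ N _ K _ _ Dt H ιK P hC _hN hK _hdisc hHeeg _hL1 _hP _hc _hfin _hodd κ hκ γ _ 𝔭 h𝔭 _he _hf
    𝔭bar h𝔭bar hne _hsplit f _hf' ι' _hι' ΩK Ωp Q _hΩK _hΩp _hBDP L x D _hLxD _τΛ A₂ _ _ _ _ ρ₂ _τB _ _ hFD _hfg hreg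
  obtain ⟨hcof, htor, -, -, ⟨S₀, hS₀f, hunr, hS₀N⟩, ⟨θ₀, hθC, -, hker, -⟩, -⟩ := hFD
  obtain ⟨s, hs, hsX⟩ := hreg
  obtain ⟨-, hp2, -, -⟩ := hC
  have hpK : ((p : ℕ) : 𝓞 K) ≠ 0 := by exact_mod_cast (Fact.out : p.Prime).ne_zero
  -- the finite set `S := S₀ ∪ {w ∣ p}` and the descent of `𝐃` to `G_{K,S}`
  set S : Set (HeightOneSpectrum (𝓞 K)) := S₀ ∪ {w | ((p : ℕ) : 𝓞 K) ∈ w.asIdeal} with hSdef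
  have hSf : S.Finite := hS₀f.union (TelescopeK2BigRepUnramified.finite_setOf_natCast_mem hpK)
  have hSsub : ∀ w : HeightOneSpectrum (𝓞 K), w ∉ S → w ∉ S₀ ∧ ((p : ℕ) : 𝓞 K) ∉ w.asIdeal :=
    fun w hw ↦ ⟨fun h ↦ hw (Or.inl h), fun h ↦ hw (Or.inr h)⟩
  have hSp : ∀ v : HeightOneSpectrum (𝓞 K), ((p : ℕ) : 𝓞 K) ∈ v.asIdeal → v ∈ S := fun v hv ↦ Or.inr hv
  have hS := TelescopeK2BigRepUnramified.ramificationSubgroup_le_ker_anticyclotomicBigGaloisRep κ ρ₂ hunr S hSsub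
  -- `A₂` is `p`-primary (from the fibre datum at `X = 0`), `ℤ_p ↪ ℤ_p⟦X⟧`
  have hPT : ∀ y : PrimaryTorsion (W.baseChange K).geomPoints p, ∃ k : ℕ, ((p : ℤ_[p]) ^ k) • y = 0 :=
    fun y ↦ TelescopeK2FibreCofinite.primaryTorsion_exists_pow_smul_eq_zero y
  have hA : ∀ a : A₂, ∃ k : ℕ, p ^ k • a = 0 := TelescopeK2PurityDocked.pPrimary_of_fd p hPT htor θ₀ hθC hker
  have hinj : Function.Injective (algebraMap ℤ_[p] (PowerSeries ℤ_[p])) := fun a b h ↦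
    PowerSeries.C_injective (by simpa only [PowerSeries.C_eq_algebraMap] using h)
  -- the four local rows
  have h1 : LOC1 S (TelescopeK2RepDescent.descendUnramified S (AnticyclotomicBigGaloisRep κ ρ₂) hS) (Sum.inr 𝔭) :=
    TelescopeK2BigRepLOC1.loc1_descendUnramified_of_isAnticyclotomic S κ ρ₂ hS hinj hA hcof hK hp2 hκ 𝔭 h𝔭
  have h2 : LOC1 S (TelescopeK2RepDescent.descendUnramified S (AnticyclotomicBigGaloisRep κ ρ₂) hS) (Sum.inr 𝔭bar) :=
    TelescopeK2BigRepLOC1.loc1_descendUnramified_of_isAnticyclotomic S κ ρ₂ hS hinj hA hcof hK hp2 hκ 𝔭bar h𝔭bar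
  have h0 : HasCorank (PowerSeries (PowerSeries ℤ_[p])) ((localRep S
      (TelescopeK2RepDescent.descendUnramified S (AnticyclotomicBigGaloisRep κ ρ₂) hS) (Sum.inr 𝔭bar)).H 0) 0 :=
    TelescopeK2BigRepLOC1.hasCorank_localH0_descendUnramified_zero_of_isAnticyclotomic S κ ρ₂ hS hinj hA hcof hK hp2
      hκ 𝔭bar h𝔭bar
  have hcot : ∀ w ∈ S, ((p : ℕ) : 𝓞 K) ∉ w.asIdeal → IsCotorsion (PowerSeries (PowerSeries ℤ_[p])) ((localRep S
      (TelescopeK2RepDescent.descendUnramified S (AnticyclotomicBigGaloisRep κ ρ₂) hS) (Sum.inr w)).H 1) := by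
    intro w hw hpw
    have hwS₀ : w ∈ S₀ := by
      rw [hSdef] at hw
      rcases hw with h | h
      exacts [h, absurd h hpw]
    obtain ⟨he, hf⟩ := TelescopeK2WeightTwoPseudoNull.degreeOne_of_satisfiesHeegnerHypothesis hK.1 hHeeg w (hS₀N w hwS₀ hpw)
    exact TelescopeK2PurityFactFree.isCotorsion_localH1_of_h0_of_loc1 p κ ρ₂ hA hcof S hSf hSp hS hpw
      (TelescopeK2BigRepLOC1.hasCorank_localH0_descendUnramified_zero_of_degreeOne S κ ρ₂ hS hinj hA hcof hK hκ w
        hpw he hf)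
      (TelescopeK2BigRepLOC1.loc1_descendUnramified_of_degreeOne S κ ρ₂ hS hinj hA hcof hK hκ w hpw he hf)
  exact TelescopeK2PurityDocked.forall_isPseudoNull_XBig_exists_pow_smul_eq_zero_of_isUnramifiedOutside p hK κ ρ₂
    hcof hPT htor θ₀ hθC hker hunr S hSf hSsub h𝔭 h𝔭bar hne h1 h2 h0 hcot hs hsX

end Summit.BirchSwinnertonDyer.BirchSwinnertonDyer.Theorems.TelescopeWeightTwoPseudoNullOfPub21

end
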